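import Summits.KontsevichZagierPeriods.Zeta5Search.Certificates.RecordRayDenominatorsBricksLaw
import HarnessLib

/-!
# ζ(5) search — the record ray's DENOMINATORS, XI-d: a fourth window source — CLASS-LAW WINDOWS by name (p3 g6)

HONEST FRAMING: systematic search; no irrationality claim unless certified.

OUR work (Summit side; prover seat p3, generation 6).  Files XI-a/b/c consume three window sources through Boolean checks
(atlas33 sub-windows, fam-denom brick cells, the law-M window).  This file adds a GENERIC fourth source: a list of
CLASS-LAW WINDOWS `cw : List CWin`, each a record `⟨a₁, a₂, b₁, b₂, N₀, B⟩` standing for a tree theorem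
`CWin.Holds c : ∀ n ≥ N₀, ∀ p prime, a₁n < a₂p → b₂p < b₁n → 41n + 2 < p² → Cas₇(b(n)) ≠ 0 → B ≤ v_p(Cas₇(b(n)))`
(the machine-generated `RecordLetters*.window` theorems: the census by-name LETTERS windows, J / B rungs scale-free), and

* `BWin.okClass cw w` (source kind `3`): the table window `w` lies inside `cw[w.idx]` (`θ ≥ 1`), the twelve integer parts
  `⌊c·n/p⌋` (`c ∈ {8,…,18,25}`) are CONSTANT on `w` (decidable: `⌊c·b₂/b₁⌋ = v` and `c·a₂ ≤ (v+1)·a₁`, `floor_pin`), and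
  `k ≤ 9 + 2·v_p(N♯) + B`, `k ≤ 9 + 2·v_p(N♯) − v_p(ρ)` with the valuations read off those integer parts
  (`cell_core` of file V); soundness `BWin.sound_of_okClass` under `∀ c ∈ cw, c.Holds`;
* `BWin.ok3 cw = ok2 ∨ (okShape ∧ okClass cw)` with `sound_of_ok3`, `soundList_of_all_ok3`, `all_ok3_of_all_ok2` — so a table
  file lists windows, runs `decide`, and gets its exponent from `record_exponent_of_sound` (file XI-c).

Valuation bookkeeping; every `γ < 1` — no irrationality content.
-/

noncomputable section

open Finset Real Filter Topology

namespace Summit.KontsevichZagierPeriods.Zeta5Search.RecordRay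

open Summit.KontsevichZagierPeriods.Zeta5Search.DualSeries
open Summit.KontsevichZagierPeriods.Zeta5Search.DualSeriesDenominators
open Summit.KontsevichZagierPeriods.Zeta5Search.WedgeDictionary
open Summit.KontsevichZagierPeriods.Zeta5Search.DualSeriesLemma19 (bRecord)
open Summit.KontsevichZagierPeriods.Zeta5Search.CasoratianValuation (casoratian shift)
open Summit.KontsevichZagierPeriods.Zeta5Search.ClusterValuation (bRec)

/-- A CLASS-LAW WINDOW of the record ray: `θ = p/n ∈ (a₁/a₂, b₁/b₂)` (both ends open), valid from `n ≥ N0`, Casoratian bound `B`. -/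
structure CWin where
  /-- left endpoint numerator -/
  a1 : ℕ
  /-- left endpoint denominator -/
  a2 : ℕ
  /-- right endpoint numerator -/
  b1 : ℕ
  /-- right endpoint denominator -/
  b2 : ℕ
  /-- least `n` -/
  N0 : ℕ
  /-- the bound `B ≤ v_p(Cas₇(b(n)))` -/
  B : ℤ

/-- The statement a class-law window stands for. -/
def CWin.Holds (c : CWin) : Prop :=
  ∀ n p : ℕ, c.N0 ≤ n → p.Prime → c.a1 * n < c.a2 * p → c.b2 * p < c.b1 * n → 41 * n + 2 < p ^ 2 →
    casoratian (bRec n) 7 ≠ 0 → c.B ≤ padicValRat p (casoratian (bRec n) 7)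

/-! ### Pinning an integer part on a window -/

/-- **`⌊c·n/p⌋ = v` on the window `a₁n < a₂p`, `b₂p ≤ b₁n`** as soon as `v·b₁ ≤ c·b₂` and `c·a₂ ≤ (v+1)·a₁`. -/
theorem floor_pin {a1 a2 b1 b2 c v n p : ℕ} (hb1 : 0 < b1) (hlo : a1 * n < a2 * p)
    (hhi : b2 * p ≤ b1 * n) (hv1 : v * b1 ≤ c * b2) (hv2 : c * a2 ≤ (v + 1) * a1) : c * n / p = v := by
  apply Nat.div_eq_of_lt_le
  · -- v p ≤ c n :  b1 (v p) = v (b1 ...)  ≤ ...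
    have h1 : b1 * (v * p) ≤ b1 * (c * n) := by
      calc b1 * (v * p) = (v * b1) * p := by ring
        _ ≤ (c * b2) * p := Nat.mul_le_mul_right p hv1
        _ = c * (b2 * p) := by ring
        _ ≤ c * (b1 * n) := Nat.mul_le_mul_left c hhi
        _ = b1 * (c * n) := by ring
    exact Nat.le_of_mul_le_mul_left h1 hb1
  · have h1 : a2 * (c * n) < a2 * ((v + 1) * p) := by
      calc a2 * (c * n) = (c * a2) * n := by ring
        _ ≤ ((v + 1) * a1) * n := Nat.mul_le_mul_right n hv2
        _ = (v + 1) * (a1 * n) := by ring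
        _ < (v + 1) * (a2 * p) := Nat.mul_lt_mul_of_pos_left hlo (by omega)
        _ = a2 * ((v + 1) * p) := by ring
    exact Nat.lt_of_mul_lt_mul_left h1

namespace BWin

/-- The pinned integer part `⌊c·b₂/b₁⌋` of a table window. -/
def fl (w : BWin) (c : ℕ) : ℕ := c * w.b2 / w.b1

/-- The integer part of `c·n/p` is constant (`= fl w c`) on the window. -/
def okFloor (w : BWin) (c : ℕ) : Bool := decide (c * w.a2 ≤ (w.fl c + 1) * w.a1)

/-- `v_p(N♯(b)) = v_p(N♯(b′))` read off the pinned integer parts. -/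
def vN (w : BWin) : ℤ :=
  ((w.fl 12 + w.fl 13 + w.fl 14 + w.fl 15 + w.fl 14 + w.fl 13 : ℕ) : ℤ) - ((w.fl 16 : ℕ) : ℤ) - ((w.fl 15 : ℕ) : ℤ)

/-- `v_p(ρ(a·n))` read off the pinned integer parts. -/
def vrho (w : BWin) : ℤ :=
  ((w.fl 8 + w.fl 9 + w.fl 10 + w.fl 11 + w.fl 10 + w.fl 11 + w.fl 12 + w.fl 13 + w.fl 12 + w.fl 14 + w.fl 15 + w.fl 16 +
      w.fl 16 + w.fl 17 + w.fl 18 : ℕ) : ℤ) - ((w.fl 17 + w.fl 14 + w.fl 13 + w.fl 12 + w.fl 11 + w.fl 25 : ℕ) : ℤ)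

/-- Source check, kind `3`: the window lies in the class-law window `cw[idx]` (`θ ≥ 1`, `0 < b₁ᶜ < 10496`, `N₀ᶜ ≤ 10496`), the twelve
integer parts are pinned, and `k ≤ 9 + 2 v_p(N♯) + B`, `k ≤ 9 + 2 v_p(N♯) − v_p(ρ)`. -/
def okClass (cw : List CWin) (w : BWin) : Bool :=
  (w.kind == 3) &&
    match cw[w.idx]? with
    | some c =>
        decide (0 < c.a2) && decide (c.a2 ≤ c.a1) && decide (0 < c.b1) && decide (c.b1 < 10496) && decide (c.N0 ≤ 10496) &&
          decide (c.a1 * w.a2 ≤ w.a1 * c.a2) && decide (w.b1 * c.b2 ≤ c.b1 * w.b2) &&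
          (w.okFloor 8 && w.okFloor 9 && w.okFloor 10 && w.okFloor 11 && w.okFloor 12 && w.okFloor 13 && w.okFloor 14 &&
            w.okFloor 15 && w.okFloor 16 && w.okFloor 17 && w.okFloor 18 && w.okFloor 25) &&
          decide ((w.k : ℤ) ≤ 9 + w.vN + w.vN + c.B) && decide ((w.k : ℤ) ≤ 9 + w.vN + w.vN - w.vrho)
    | none => false

/-- The extended check: `ok2` (kinds 0, 1, 2) or a shape-checked class-law window (kind 3). -/
def ok3 (cw : List CWin) (w : BWin) : Bool := w.ok2 || (w.okShape && w.okClass cw)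

section Sound

variable {n p : ℕ}

/-- A pinned floor on an `okShape` window. -/
theorem fl_eq {w : BWin} (hs : w.okShape = true) {c : ℕ} (hc : w.okFloor c = true) (hlo : w.a1 * n < w.a2 * p)
    (hhi : w.b2 * p ≤ w.b1 * n) : c * n / p = w.fl c := by
  simp only [okShape, Bool.and_eq_true, decide_eq_true_eq] at hs
  obtain ⟨⟨⟨⟨⟨ha1, -⟩, hb2⟩, hab⟩, -⟩, -⟩ := hs
  simp only [okFloor, decide_eq_true_eq] at hc
  have hb1 : 0 < w.b1 := by
    rcases Nat.eq_zero_or_pos w.b1 with h | h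
    · exfalso
      have hpos := Nat.mul_pos ha1 hb2
      rw [h] at hab; simp at hab; omega
    · exact h
  exact floor_pin hb1 hlo hhi (Nat.div_mul_le_self _ _) hc

/-- **Soundness, kind `3`**: a prime of a window inside a class-law window gets `p^k` through `cell_core`. -/
theorem sound_of_okClass {cw : List CWin} (hcw : ∀ c ∈ cw, c.Holds) {w : BWin} (hs : w.okShape = true)
    (h : w.okClass cw = true) : w.Sound := by
  intro n p hn hp hlo hhi zW zV zW' zV' zU zU' hzW hzV hzW' hzV' hzU hzU'
  have hs' := hs
  simp only [okClass, Bool.and_eq_true, beq_iff_eq] at h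
  obtain ⟨-, h⟩ := h
  split at h
  · rename_i c hc
    simp only [Bool.and_eq_true, decide_eq_true_eq] at h
    obtain ⟨⟨⟨⟨⟨⟨⟨⟨⟨hca2, hcaa⟩, hb1pos⟩, hcb1⟩, hcN⟩, hL⟩, hR⟩, hF⟩, hk1⟩, hk2⟩ := h
    obtain ⟨⟨⟨⟨⟨⟨⟨⟨⟨⟨⟨f8, f9⟩, f10⟩, f11⟩, f12⟩, f13⟩, f14⟩, f15⟩, f16⟩, f17⟩, f18⟩, f25⟩ := hF
    simp only [okShape, Bool.and_eq_true, decide_eq_true_eq] at hs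
    obtain ⟨⟨⟨⟨⟨ha1, ha2⟩, hb2⟩, hab⟩, -⟩, h41⟩ := hs
    have hcmem : c ∈ cw := List.mem_iff_getElem?.mpr ⟨w.idx, hc⟩
    have hn1 : 1 ≤ n := by omega
    -- the class-law window's hypotheses
    have hclo : c.a1 * n < c.a2 * p := by
      have h1 : c.a1 * w.a2 * n ≤ w.a1 * c.a2 * n := Nat.mul_le_mul_right n hL
      have h2 : c.a2 * (w.a1 * n) < c.a2 * (w.a2 * p) := Nat.mul_lt_mul_of_pos_left hlo hca2
      have h3 : w.a2 * (c.a1 * n) < w.a2 * (c.a2 * p) := by nlinarith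
      exact Nat.lt_of_mul_lt_mul_left h3
    have hnp : n < p := by
      have : c.a2 * n ≤ c.a1 * n := Nat.mul_le_mul_right n hcaa
      have h2 : c.a2 * n < c.a2 * p := by omega
      exact Nat.lt_of_mul_lt_mul_left h2
    have hchi : c.b2 * p < c.b1 * n := by
      have h2 : w.b2 * (c.b2 * p) ≤ w.b2 * (c.b1 * n) := by
        calc w.b2 * (c.b2 * p) = c.b2 * (w.b2 * p) := by ring
          _ ≤ c.b2 * (w.b1 * n) := Nat.mul_le_mul_left _ hhi
          _ = (w.b1 * c.b2) * n := by ring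
          _ ≤ (c.b1 * w.b2) * n := Nat.mul_le_mul_right n hR
          _ = w.b2 * (c.b1 * n) := by ring
      have hle : c.b2 * p ≤ c.b1 * n := Nat.le_of_mul_le_mul_left h2 hb2
      rcases hle.lt_or_eq with hlt | heq
      · exact hlt
      · exfalso
        have hdvd : p ∣ c.b1 * n := ⟨c.b2, by rw [← heq]; ring⟩
        rcases (Nat.Prime.dvd_mul hp).1 hdvd with h1 | h1
        · exact absurd (Nat.le_of_dvd hb1pos h1) (by omega)
        · exact absurd (Nat.le_of_dvd (by omega) h1) (by omega)
    have hp41 : p ≤ 41 * n := by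
      have : w.b2 * p ≤ w.b2 * (41 * n) := by nlinarith
      exact Nat.le_of_mul_le_mul_left this hb2
    have hsq2 : 41 * n + 2 < p ^ 2 := by nlinarith
    have hsq : 41 * n < p ^ 2 := by omega
    have hp14 : 14 < p := by omega
    have hp2 : p ≠ 2 := by omega
    -- pinned integer parts
    have e8 := fl_eq hs' f8 hlo hhi
    have e9 := fl_eq hs' f9 hlo hhi
    have e10 := fl_eq hs' f10 hlo hhi
    have e11 := fl_eq hs' f11 hlo hhi
    have e12 := fl_eq hs' f12 hlo hhi
    have e13 := fl_eq hs' f13 hlo hhi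
    have e14 := fl_eq hs' f14 hlo hhi
    have e15 := fl_eq hs' f15 hlo hhi
    have e16 := fl_eq hs' f16 hlo hhi
    have e17 := fl_eq hs' f17 hlo hhi
    have e18 := fl_eq hs' f18 hlo hhi
    have e25 := fl_eq hs' f25 hlo hhi
    have hvN : padicValRat p (sharpNormaliser (bRecord n)) = w.vN := by
      rw [padicValRat_sharpNormaliser_bRecord hp (by omega), e12, e13, e14, e15, e16]; rfl
    have hvN' : padicValRat p (sharpNormaliser (bRecord' n)) = w.vN := by
      rw [padicValRat_sharpNormaliser_bRecord' hn1 hp hnp hp14 (by omega), e12, e13, e14, e15, e16]; rfl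
    have hvr : padicValRat p (rhoOf (aRec n)) = w.vrho := by
      rw [padicValRat_rhoOf_aRec hp hp2 (by omega), e8, e9, e10, e11, e12, e13, e14, e15, e16, e17, e18, e25]; rfl
    have hcas : casoratian (bRecord n) 7 ≠ 0 → c.B ≤ padicValRat p (casoratian (bRecord n) 7) := by
      intro hne
      rw [bRecord_eq_bRec] at hne ⊢
      exact hcw c hcmem n p (by omega) hp hclo hchi hsq2 hne
    exact cell_core hn1 hp hp41 hsq hvN hvN' hvr hcas (k := w.k) (by linarith) (by linarith) hzW hzV hzW' hzV' hzU hzU'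
  · exact absurd h Bool.false_ne_true

/-- `ok3 ⇒ okShape`. -/
theorem okShape_of_ok3 {cw : List CWin} {w : BWin} (h : w.ok3 cw = true) : w.okShape = true := by
  simp only [ok3, Bool.or_eq_true, Bool.and_eq_true] at h
  rcases h with h | ⟨hs, -⟩
  · exact okShape_of_ok2 h
  · exact hs

/-- `ok3 ⇒ Sound` (given the class-law windows). -/
theorem sound_of_ok3 {cw : List CWin} (hcw : ∀ c ∈ cw, c.Holds) {w : BWin} (h : w.ok3 cw = true) : w.Sound := by
  have h' := h
  simp only [ok3, Bool.or_eq_true, Bool.and_eq_true] at h'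
  rcases h' with h1 | ⟨hs, hl⟩
  · exact sound_of_ok2 h1
  · exact sound_of_okClass hcw hs hl

end Sound

end BWin

namespace BrickAtlas

variable {l : List BWin}

/-- A list checked by `ok3` is sound (given the class-law windows). -/
theorem soundList_of_all_ok3 {cw : List CWin} (hcw : ∀ c ∈ cw, c.Holds) (hok : l.all (BWin.ok3 cw) = true) :
    SoundList l := fun i =>
  have h := List.all_eq_true.1 hok _ (List.getElem_mem i.isLt)
  ⟨BWin.okShape_of_ok3 h, BWin.sound_of_ok3 hcw h⟩

/-- `ok2`-checked lists are `ok3`-checked. -/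
theorem all_ok3_of_all_ok2 (cw : List CWin) (hok : l.all BWin.ok2 = true) : l.all (BWin.ok3 cw) = true := by
  rw [List.all_eq_true] at hok ⊢
  intro w hw
  have := hok w hw
  simp only [BWin.ok3, Bool.or_eq_true]
  exact Or.inl this

/-- `ok`-checked lists are `ok3`-checked. -/
theorem all_ok3_of_all_ok (cw : List CWin) (hok : l.all BWin.ok = true) : l.all (BWin.ok3 cw) = true :=
  all_ok3_of_all_ok2 cw (all_ok2_of_all_ok hok)

/-- **The exponent of a table checked by `ok3`.** -/
theorem record_exponent_of_table3 {cw : List CWin} (hcw : ∀ c ∈ cw, c.Holds) (hok : l.all (BWin.ok3 cw) = true)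
    (hch : chainSep l = true) {γ : ℝ} (hγ0 : 0 ≤ γ)
    (hγ : γ * ((((3815232 / 10000 - rateQ l : ℚ) : ℝ) + 2 / 100) + 8508768884 / 10 ^ 8) <
      8508768883 / 10 ^ 8 + 315452 / 10000) :
    ∀ᶠ n : ℕ in atTop, ∃ p : ℤ, ∃ q : ℕ, 1 ≤ q ∧ (q : ℚ) = ML l n * |(recordQ n : ℚ)| ∧ (p : ℚ) = ML l n * recordP n ∧
      |Literature.NumberTheory.Transcendental.zetaValue 5 - (recordP n : ℝ) / (recordQ n : ℝ)| < 1 / (q : ℝ) ^ γ :=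
  record_exponent_of_sound (soundList_of_all_ok3 hcw hok) hch hγ0 hγ

end BrickAtlas

end Summit.KontsevichZagierPeriods.Zeta5Search.RecordRay
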